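import Summits.QuantumFields.YangMills.Theorems.BalabanUVNodesN15TwoSpacingGluingCurvedKnitCovariantLandauGlobalRows
import Summits.QuantumFields.YangMills.Theorems.BalabanUVNodesN15LiveGluedPropagatorIncrementDefect
import HarnessLib

/-!
# N15 = NE2 — dag-n15-a g32 (t2), F4: (I-c)_r — THE TWO-GRID η-DEFECT ROW OF THE INCREMENT OF dag-n15-c's (P-R) PROPAGATOR `X_r` (Bałaban's whole covariant summand live INSIDE the
# propagator): n15-c∕206 `sfqr_idef_cvGlued` − FILE 21 conjunct 6, the six Landau-letter rows fed from n15-c∕211's THREE global rows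
# (dag-n15-a g32, (t2) FILE F4; node N15 = NE2; `--kind proof --supports stmt-QuantumFields-27366 --as helper`, count-neutral; one theorem, 0 def; imports n15-c 211 (⊇ 206, 207), (I-c))

WHY ∕ HOW.  The third displayed row of (𝟙P-b)∕(𝟙P-c′)∕(𝟙P-d′) for an inner propagator family is the two-grid η-defect of its INCREMENT over the flat zero-field pair along King's pairing
`⊗ 1_ι`.  For dag-n15-c's `X_r` (207a `sfqrEntry0`: `P := cvNL − cvNVq(U) − cvNVr(U)`, `NV := cvNVq(U) + cvNVr(U)`, `U = e^{ηĀ′}` ∕ `U′ = e^{η′A′}`) this is n15-c∕206 `sfqr_idef_cvGlued`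
(δ-capped over n15-c∕209) — the defect of the live pair `(X′_r, X_r)`, majorant `D·[(L^k)^{−1∕16} + S(1+|J⊕J|)η + 2(R₁(20η + 4φ) + (o_R + r_{D,R}))]·e^{−(δ∕16)d}` with SIX Landau-letter
rows displayed — MINUS FILE 21 conjunct 6 (`uniform_layer_fullGM₂`: `|𝔇((G′, G)⊗1)| ≤ m₀(L^k)^{−1∕16}e^{−δ_G d}`), by linearity of `𝔇` in the pair (`idef_sub`), exactly as (𝟙P-e‴) did for
`X_q`; the six rows come from n15-c∕211 §1 `cv_landauRows_of_global` fed with the THREE cut-off-free rows (the displayed debt of record), at rate `δ_e` slowed to 206's rate.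

THE RESULT ★★ `exists_hasMaj_idef_sfqr_sub_tensorId_gOp … (hδe : 0 < δe)`: `∃ δ ≤ δ_e, w₀ R₀ θ₀ R₁ K > 0` such that in 206's regime, with the Landau letters `ρ_R` (size, both grids; in both
budgets) and `o_R` (two-grid defect) and the three global rows at rate `δ_e`: `|𝔇_{P̂,P̂}(X′_r − G′⊗1, X_r − G⊗1)| ≤ K·[206's bracket, r_{D,R} = o_R]·e^{−δd}`, `K = |D| + m₀`.

HONEST FRAMING ∕ LIMITS.  MODEL operators of dag-n15-c on MODEL carriers (doubled torus, global small-field gauge, `Q(U)` = main term (125), King-block-mean pairing, crude constants); the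
Landau rows are HYPOTHESES (dag-n15-c's located-next analytic object, [B9] §1∕(3.49)); the (3.42)-entry SHAPE, NOT [B9] Thm 3.1∕3.4∕3.14 as printed; no layer knit here; N15 stays
DISCHARGED OF RECORD 8∕28 AS CONSUMED (U-blind v7 pin, p687738) — nothing re-claimed, no count moved; K3⁸ OPEN; finite 𝕋⁴ per index — NOT ℝ⁴ ∕ OS ∕ mass gap ∕ Clay.
`set_option maxHeartbeats 800000 in` ×1 ((𝟙P-e‴)'s budget).  No `sorry`, `instance`, `notation`; standard axioms.
-/

noncomputable section

open scoped BigOperators Matrix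

namespace Summit.QuantumFields.YangMills.BalabanUVNodes.N15.GluedZeroField

open Literature.MathematicalPhysics.QuantumFieldTheory.Balaban1983to89
open Literature.MathematicalPhysics.QuantumFieldTheory.Balaban1983to89.B5Prop11Plancherel (Tor fine)
open Literature.MathematicalPhysics.QuantumFieldTheory.Balaban1983to89.B11SectG (BlockNorm HasMaj)
open Literature.MathematicalPhysics.QuantumFieldTheory.Balaban1983to89.B6UnitTorusCarrier (unitTorusGeo unitTorusGeo_dist_nonneg)
open Literature.MathematicalPhysics.QuantumFieldTheory.Balaban1983to89.T4EtaRateDefect (idef idef_sub)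
open Literature.MathematicalPhysics.QuantumFieldTheory.Balaban1983to89.T4EtaRateCoeffDefect (pull)
open Literature.MathematicalPhysics.QuantumFieldTheory.King1986.Torus (blockOf tdistT)
open Literature.Barriers.QuantumFields (traceForm)
open Summit.QuantumFields.YangMills.BalabanUVNodes.N15.BackgroundLayer (gavgM uniform_layer_fullGM₂)
open Summit.QuantumFields.YangMills.BalabanUVNodes.N15.SiteLayer (hasMaj_exp_mono)
open Summit.QuantumFields.YangMills.BalabanUVNodes.N15.VectorPiece (bshiftEquiv kingPrV tensorId blkFine_comp_kingPrV)
open Summit.QuantumFields.YangMills.BalabanUVNodes.N15.MatrixSpecies (basisConst basisConst_nonneg liftBlk liftMap)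
open Summit.QuantumFields.YangMills.BalabanUVNodes.N15.TwoGrid (gOp)
open Summit.QuantumFields.YangMills.BalabanUVNodes.N15.Gluing (cvM CvX CvX' cvBlk CvNorm cvNL cvNL' cvGlued cvGlued' cvNVq cvNVq' cvNVr cvNVr' sfqr_idef_cvGlued cv_landauRows_of_global)

variable {d : ℕ} {L : ℕ} [NeZero L]

/-! ## ★★ (I-c)_r: the two-grid η-defect of the increment of `X_r` -/

section Defect

open scoped Matrix.Norms.L2Operator

set_option maxHeartbeats 800000 in
/-- ★★ **THE η-DEFECT OF THE INCREMENT OF `X_r` IS η-SMALL — (I-c)_r**: for every `δ_e > 0`, `∃ δ ≤ δ_e, w₀ R₀ θ₀ R₁ K > 0` (from `d, L, a, ι, δ_e`) such that in n15-c∕206's regime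
(hypothesis block verbatim: skew `A′` in FILE 130's C² window at scale `r_A ≤ 1`, transporter sizes `K, K₁ ≤ 1`) with ONE Landau size letter `ρ_R ≥ 0` in both budgets and ONE Landau
defect letter `o_R ≥ 0`, IF n15-c∕211's THREE cut-off-free Landau rows hold at rate `δ_e` (`N_V^R(e^{ηĀ′}) ≤ ρ_R e^{−δ_e d}` coarse, `N_V^R′(e^{η′A′}) ≤ ρ_R e^{−δ_e d}` fine,
`𝔇(N_V^R′, N_V^R) ≤ o_R e^{−δ_e d}`), THEN the two-grid η-defect along King's pairing `⊗ 1_ι` of the pair of increments `(X′_r(A′) − G′⊗1, X_r(A′) − G⊗1)` has the block majorant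
`K·[206's bracket with r_{D,R} = o_R]·e^{−δd}` — `𝔇` is linear in the pair: n15-c∕206 `sfqr_idef_cvGlued` (δ-capped; its six Landau-letter rows produced from the three global ones by
n15-c∕211 `cv_landauRows_of_global`) minus FILE 21's defect of `(G′, G)⊗1`.  MODEL operators; the Landau rows are HYPOTHESES; NOT any printed estimate.
[cite: Balaban1985BackgroundPropagators, Thm 3.1 (3.42) p.397 (shape), (3.25)–(3.26) p.395, (3.49) p.398; Balaban1984PropagatorsI, Prop. 1.2 (1.110)–(1.111) p.35; King1986, p.664] -/
theorem exists_hasMaj_idef_sfqr_sub_tensorId_gOp (hL : Odd L ∧ 1 < L) (hL7 : 7 ≤ L) {a : ℝ} (ha : 0 < a) (ι : Type) [Fintype ι] [DecidableEq ι] [Nonempty ι] {δe : ℝ} (hδe : 0 < δe) :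
    ∃ δ w₀ R₀ θ₀ R₁ K : ℝ, 0 < δ ∧ δ ≤ δe ∧ 0 < R₀ ∧ 0 < θ₀ ∧ 0 < R₁ ∧ 0 < K ∧
      ∀ (mv kk r : ℕ), 1 ≤ kk → w₀ ≤ ((L ^ mv : ℕ) : ℝ) →
      ∀ {mm : Type} [Fintype mm] [DecidableEq mm] [Nonempty mm] (e : Matrix mm mm ℂ ≃L[ℝ] (ι → ℝ)), (∀ A B : Matrix mm mm ℂ, traceForm A B = e A ⬝ᵥ e B) →
      ∀ (A' : Fin (d + 1) → CvX' d L mv kk r hL → Matrix mm mm ℂ), (∀ μ x', (A' μ x')ᴴ = -A' μ x') →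
      ∀ (rA : ℝ), 0 ≤ rA → rA ≤ 1 → (∀ μ x', ‖A' μ x'‖ ≤ rA) →
        (∀ μ κ x', ‖A' μ (bshiftEquiv (cvM d L mv kk hL) (L ^ r * L ^ kk) κ x') - A' μ x'‖ ≤ rA * ((((L ^ r * L ^ kk : ℕ) : ℝ))⁻¹)) →
        (∀ μ κ x', ‖(A' μ (bshiftEquiv (cvM d L mv kk hL) (L ^ r * L ^ kk) κ x') - A' μ x') -
            (A' μ (bshiftEquiv (cvM d L mv kk hL) (L ^ r * L ^ kk) κ ((bshiftEquiv (cvM d L mv kk hL) (L ^ r * L ^ kk) μ).symm x')) -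
              A' μ ((bshiftEquiv (cvM d L mv kk hL) (L ^ r * L ^ kk) μ).symm x'))‖ ≤ rA * ((((L ^ r * L ^ kk : ℕ) : ℝ))⁻¹) * ((((L ^ r * L ^ kk : ℕ) : ℝ))⁻¹)) →
        2 * ((1 + Fintype.card (Fin (d + 1))) * ((3 + 2 * ((d : ℝ) + 1)) * rA)) ≤ 1 →
      ∀ (ρR oR : ℝ), 0 ≤ ρR → 0 ≤ oR →
        (14 * Real.exp 1 * (1 + Fintype.card (Fin (d + 1))) * basisConst e * ((1 + Fintype.card (Fin (d + 1))) * ((3 + 2 * ((d : ℝ) + 1)) * rA))) * (1 + Fintype.card (Fin (d + 1) ⊕ Fin (d + 1))) + R₁ * (((1 + Fintype.card ι * (@basisConst ι _ (Matrix mm mm ℂ) Matrix.frobeniusNormedAddCommGroup Matrix.frobeniusNormedSpace e * (2 * Real.sqrt (Fintype.card mm)) * (Real.sqrt (Fintype.card mm) * (2 * (rA * ((((L ^ kk : ℕ) : ℝ))⁻¹)))))) ^ ((d + 2) * L ^ kk) - 1) + ((1 + Fintype.card ι * (@basisConst ι _ (Matrix mm mm ℂ) Matrix.frobeniusNormedAddCommGroup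 Matrix.frobeniusNormedSpace e * (2 * Real.sqrt (Fintype.card mm)) * (Real.sqrt (Fintype.card mm) * (2 * (rA * ((((L ^ r * L ^ kk : ℕ) : ℝ))⁻¹)))))) ^ ((d + 2) * (L ^ r * L ^ kk)) - 1)) + ρR ≤ R₀ →
        R₁ * (((1 + Fintype.card ι * (@basisConst ι _ (Matrix mm mm ℂ) Matrix.frobeniusNormedAddCommGroup Matrix.frobeniusNormedSpace e * (2 * Real.sqrt (Fintype.card mm)) * (Real.sqrt (Fintype.card mm) * (2 * (rA * ((((L ^ kk : ℕ) : ℝ))⁻¹)))))) ^ ((d + 2) * L ^ kk) - 1) + ((1 + Fintype.card ι * (@basisConst ι _ (Matrix mm mm ℂ) Matrix.frobeniusNormedAddCommGroup Matrix.frobeniusNormedSpace e * (2 * Real.sqrt (Fintype.card mm)) * (Real.sqrt (Fintype.card mm) * (2 * (rA * ((((L ^ r * L ^ kk : ℕ) : ℝ))⁻¹)))))) ^ ((d + 2) * (L ^ r * L ^ kk)) - 1)) + ρR ≤ θ₀ →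
        ((1 + Fintype.card ι * (@basisConst ι _ (Matrix mm mm ℂ) Matrix.frobeniusNormedAddCommGroup Matrix.frobeniusNormedSpace e * (2 * Real.sqrt (Fintype.card mm)) * (Real.sqrt (Fintype.card mm) * (2 * (rA * ((((L ^ kk : ℕ) : ℝ))⁻¹)))))) ^ ((d + 2) * L ^ kk) - 1) ≤ 1 → ((1 + Fintype.card ι * (@basisConst ι _ (Matrix mm mm ℂ) Matrix.frobeniusNormedAddCommGroup Matrix.frobeniusNormedSpace e * (2 * Real.sqrt (Fintype.card mm)) * (Real.sqrt (Fintype.card mm) * (2 * (rA * ((((L ^ r * L ^ kk : ℕ) : ℝ))⁻¹)))))) ^ ((d + 2) * (L ^ r * L ^ kk)) - 1) ≤ 1 →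
        HasMaj (CvNorm d L mv kk hL ι) (CvNorm d L mv kk hL ι) (cvNVr d L mv kk hL a ι e (fun μ x => NormedSpace.exp (((((L ^ kk : ℕ) : ℝ))⁻¹) • gavgM (Matrix mm mm ℂ) (Fin (d + 1)) (kingPrV L kk r (cvM d L mv kk hL)) A' μ x))) (fun y y' => ρR * Real.exp (-(δe * (unitTorusGeo L kk (cvM d L mv kk hL)).dist y y'))) →
        HasMaj (BlockNorm.ofBlocks (unitTorusGeo L kk (cvM d L mv kk hL)) (liftBlk (cvBlk d L mv kk hL ∘ (kingPrV L kk r (cvM d L mv kk hL))) ι)) (BlockNorm.ofBlocks (unitTorusGeo L kk (cvM d L mv kk hL)) (liftBlk (cvBlk d L mv kk hL ∘ (kingPrV L kk r (cvM d L mv kk hL))) ι)) (cvNVr' d L mv kk r hL a ι e (fun μ x' => NormedSpace.exp (((((L ^ r * L ^ kk : ℕ) : ℝ))⁻¹) • A' μ x'))) (fun y y' => ρR * Real.exp (-(δe * (unitTorusGeo L kk (cvM d L mv kk hL)).dist y y'))) →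
        HasMaj (CvNorm d L mv kk hL ι) (BlockNorm.ofBlocks (unitTorusGeo L kk (cvM d L mv kk hL)) (liftBlk (cvBlk d L mv kk hL ∘ (kingPrV L kk r (cvM d L mv kk hL))) ι)) (idef (pull (liftMap (kingPrV L kk r (cvM d L mv kk hL)) ι)) (pull (liftMap (kingPrV L kk r (cvM d L mv kk hL)) ι)) (cvNVr' d L mv kk r hL a ι e (fun μ x' => NormedSpace.exp (((((L ^ r * L ^ kk : ℕ) : ℝ))⁻¹) • A' μ x'))) (cvNVr d L mv kk hL a ι e (fun μ x => NormedSpace.exp (((((L ^ kk : ℕ) : ℝ))⁻¹) • gavgM (Matrix mm mm ℂ) (Fin (d + 1)) (kingPrV L kk r (cvM d L mv kk hL)) A' μ x)))) (fun y y' => oR * Real.exp (-(δe * (unitTorusGeo L kk (cvM d L mv kk hL)).dist y y'))) →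
        HasMaj (CvNorm d L mv kk hL ι) (BlockNorm.ofBlocks (unitTorusGeo L kk (cvM d L mv kk hL)) (liftBlk (fun b : CvX' d L mv kk r hL => blockOf (L ^ r * L ^ kk) (cvM d L mv kk hL) b.1) ι))
          (idef (pull (liftMap (kingPrV L kk r (cvM d L mv kk hL)) ι)) (pull (liftMap (kingPrV L kk r (cvM d L mv kk hL)) ι))
            ((cvGlued' d L mv kk r hL a ((((L ^ r * L ^ kk : ℕ) : ℝ))⁻¹) ι e (fun _ _ => (1 : Matrix mm mm ℂ)) (fun μ x' => NormedSpace.exp (((((L ^ r * L ^ kk : ℕ) : ℝ))⁻¹) • A' μ x')) (cvNL' d L mv kk r hL a ι - (cvNVq' d L mv kk r hL a ι e (fun μ x' => NormedSpace.exp (((((L ^ r * L ^ kk : ℕ) : ℝ))⁻¹) • A' μ x'))) - (cvNVr' d L mv kk r hL a ι e (fun μ x' => NormedSpace.exp (((((L ^ r * L ^ kk : ℕ) : ℝ))⁻¹) • A' μ x')))) (fun _ => (cvNVq' d L mv kk r hL a ι e (fun μ x' => NormedSpace.exp (((((L ^ r * L ^ kk : ℕ) : ℝ))⁻¹) • A'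 μ x'))) + (cvNVr' d L mv kk r hL a ι e (fun μ x' => NormedSpace.exp (((((L ^ r * L ^ kk : ℕ) : ℝ))⁻¹) • A' μ x'))))) - tensorId ι (gOp (cvM d L mv kk hL) (L ^ r * L ^ kk) a))
            ((cvGlued d L mv kk hL a ((((L ^ kk : ℕ) : ℝ))⁻¹) ι e (fun _ _ => (1 : Matrix mm mm ℂ)) (fun μ x => NormedSpace.exp (((((L ^ kk : ℕ) : ℝ))⁻¹) • gavgM (Matrix mm mm ℂ) (Fin (d + 1)) (kingPrV L kk r (cvM d L mv kk hL)) A' μ x)) (cvNL d L mv kk hL a ι - (cvNVq d L mv kk hL a ι e (fun μ x => NormedSpace.exp (((((L ^ kk : ℕ) : ℝ))⁻¹) • gavgM (Matrix mm mm ℂ) (Fin (d + 1)) (kingPrV L kk r (cvM d L mv kk hL)) A' μ x))) - (cvNVr d L mv kk hL a ι e (fun μ x => NormedSpace.exp (((((L ^ kk : ℕ) : ℝ))⁻¹) • gavgM (Matrix mm mm ℂ) (Fin (d + 1)) (kingPrV L kk r (cvM d L mv kk hL)) A' μ x)))) (fun _ => (cvNVq d L mv kk hL a ι e (fun μ x =>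 NormedSpace.exp (((((L ^ kk : ℕ) : ℝ))⁻¹) • gavgM (Matrix mm mm ℂ) (Fin (d + 1)) (kingPrV L kk r (cvM d L mv kk hL)) A' μ x))) + (cvNVr d L mv kk hL a ι e (fun μ x => NormedSpace.exp (((((L ^ kk : ℕ) : ℝ))⁻¹) • gavgM (Matrix mm mm ℂ) (Fin (d + 1)) (kingPrV L kk r (cvM d L mv kk hL)) A' μ x))))) - tensorId ι (gOp (cvM d L mv kk hL) (L ^ kk) a)))
          (fun y y' => K * ((((L ^ kk : ℕ) : ℝ)) ^ (-(1 / 16 : ℝ)) + ((14 * Real.exp 1 * (1 + Fintype.card (Fin (d + 1))) * basisConst e * ((1 + Fintype.card (Fin (d + 1))) * ((3 + 2 * ((d : ℝ) + 1)) * rA))) * (1 + Fintype.card (Fin (d + 1) ⊕ Fin (d + 1))) * ((((L ^ kk : ℕ) : ℝ))⁻¹) + 2 * (R₁ * (20 * ((((L ^ kk : ℕ) : ℝ))⁻¹) + 4 * Fintype.card ι * (@basisConst ι _ (Matrix mm mm ℂ) Matrix.frobeniusNormedAddCommGroup Matrix.frobeniusNormedSpace e * (2 * Real.sqrt (Fintype.card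 mm)) * (Real.sqrt (Fintype.card mm) * ((3 ^ (d + 1) * (72 * ((d : ℝ) + 1) ^ 2 + 9 * ((d : ℝ) + 1)) + (2 + 2 * Real.exp 1 + 2 * Real.exp 1 ^ 2 * ((d : ℝ) + 1))) * (rA * ((((L ^ kk : ℕ) : ℝ))⁻¹))))))) + (oR + oR))) *
            Real.exp (-(δ * (unitTorusGeo L kk (cvM d L mv kk hL)).dist y y'))) := by
  have hLpos : 0 < L := Nat.pos_of_ne_zero (NeZero.ne L)
  have hL2 : 2 ≤ L := le_trans (by norm_num) hL7
  obtain ⟨δ₁, w₀, R₀, θ₀, R₁, D, hδ₁, hδ₁e, hR₀, hθ₀, hR₁, H⟩ := sfqr_idef_cvGlued (d := d) hL hL7 ha ι hδe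
  obtain ⟨δG, βG, m₀, cT, mT, hδG, hδG₁, hβG, hm₀, -, -, -, HG⟩ :=
    uniform_layer_fullGM₂ d ι hL.1 hL2 hL ha (γ := 1 / 16) (by norm_num) le_rfl 0 (show 0 < δ₁ / 16 by positivity) le_rfl
  refine ⟨δG, w₀, R₀, θ₀, R₁, |D| + m₀, hδG, hδG₁.trans ((div_le_self hδ₁.le (by norm_num)).trans hδ₁e), hR₀, hθ₀, hR₁, by positivity, fun mv kk r hk hw₀ => ?_⟩
  intro mm _ _ _ e he A' hA' rA hrA hrA1 h1 h2 h3 hr2 ρR oR hρR hoR hRle hθle hKc hKf hG1 hG2 hG3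
  set M := cvM d L mv kk hL with hM
  have hkpos : (0 : ℝ) < ((L ^ kk : ℕ) : ℝ) := Nat.cast_pos.mpr (pow_pos hLpos kk)
  have hθ0 : 0 ≤ (((L ^ kk : ℕ) : ℝ)) ^ (-(1 / 16 : ℝ)) := Real.rpow_nonneg hkpos.le _
  have hη0 : 0 ≤ ((((L ^ kk : ℕ) : ℝ))⁻¹) := inv_nonneg.mpr hkpos.le
  have hκ0 : 0 ≤ basisConst e := basisConst_nonneg e
  have hκF := @basisConst_nonneg ι _ (Matrix mm mm ℂ) Matrix.frobeniusNormedAddCommGroup Matrix.frobeniusNormedSpace e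
  have hbr0 : 0 ≤ ((((L ^ kk : ℕ) : ℝ)) ^ (-(1 / 16 : ℝ)) + ((14 * Real.exp 1 * (1 + Fintype.card (Fin (d + 1))) * basisConst e * ((1 + Fintype.card (Fin (d + 1))) * ((3 + 2 * ((d : ℝ) + 1)) * rA))) * (1 + Fintype.card (Fin (d + 1) ⊕ Fin (d + 1))) * ((((L ^ kk : ℕ) : ℝ))⁻¹) + 2 * (R₁ * (20 * ((((L ^ kk : ℕ) : ℝ))⁻¹) + 4 * Fintype.card ι * (@basisConst ι _ (Matrix mm mm ℂ) Matrix.frobeniusNormedAddCommGroup Matrix.frobeniusNormedSpace e * (2 * Real.sqrt (Fintype.card mm)) * (Real.sqrt (Fintype.card mm) * ((3 ^ (d + 1) * (72 * ((d : ℝ) + 1) ^ 2 + 9 * ((d : ℝ) + 1)) + (2 + 2 * Real.exp 1 + 2 * Real.exp 1 ^ 2 * ((d : ℝ) + 1))) * (rA * ((((L ^ kk : ℕ) : ℝ))⁻¹))))))) + (oR + oR))) := by positivity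
  have hbrt : (((L ^ kk : ℕ) : ℝ)) ^ (-(1 / 16 : ℝ)) ≤ ((((L ^ kk : ℕ) : ℝ)) ^ (-(1 / 16 : ℝ)) + ((14 * Real.exp 1 * (1 + Fintype.card (Fin (d + 1))) * basisConst e * ((1 + Fintype.card (Fin (d + 1))) * ((3 + 2 * ((d : ℝ) + 1)) * rA))) * (1 + Fintype.card (Fin (d + 1) ⊕ Fin (d + 1))) * ((((L ^ kk : ℕ) : ℝ))⁻¹) + 2 * (R₁ * (20 * ((((L ^ kk : ℕ) : ℝ))⁻¹) + 4 * Fintype.card ι * (@basisConst ι _ (Matrix mm mm ℂ) Matrix.frobeniusNormedAddCommGroup Matrix.frobeniusNormedSpace e * (2 * Real.sqrt (Fintype.card mm)) * (Real.sqrt (Fintype.card mm) * ((3 ^ (d + 1) * (72 * ((d : ℝ) + 1) ^ 2 + 9 * ((d : ℝ) + 1)) + (2 + 2 * Real.exp 1 + 2 * Real.exp 1 ^ 2 * ((d : ℝ) + 1))) * (rA * ((((L ^ kk : ℕ) : ℝ))⁻¹))))))) + (oR + oR))) := by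
    have hR0 : 0 ≤ ((14 * Real.exp 1 * (1 + Fintype.card (Fin (d + 1))) * basisConst e * ((1 + Fintype.card (Fin (d + 1))) * ((3 + 2 * ((d : ℝ) + 1)) * rA))) * (1 + Fintype.card (Fin (d + 1) ⊕ Fin (d + 1))) * ((((L ^ kk : ℕ) : ℝ))⁻¹) + 2 * (R₁ * (20 * ((((L ^ kk : ℕ) : ℝ))⁻¹) + 4 * Fintype.card ι * (@basisConst ι _ (Matrix mm mm ℂ) Matrix.frobeniusNormedAddCommGroup Matrix.frobeniusNormedSpace e * (2 * Real.sqrt (Fintype.card mm)) * (Real.sqrt (Fintype.card mm) * ((3 ^ (d + 1) * (72 * ((d : ℝ) + 1) ^ 2 + 9 * ((d : ℝ) + 1)) + (2 + 2 * Real.exp 1 + 2 * Real.exp 1 ^ 2 * ((d : ℝ) + 1))) * (rA * ((((L ^ kk : ℕ) : ℝ))⁻¹))))))) + (oR + oR)) := by positivity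
    exact le_add_of_nonneg_right hR0
  -- 206: the defect of the live pair (constant `D` of unknown sign ↦ `|D|`, rate `δ₁∕16 ≥ δ_G`)
  have hd := fun y y' => unitTorusGeo_dist_nonneg L kk M y y'
  -- n15-c∕211 §1: the six Landau-letter rows of 206 from the three displayed global rows (rate `δ_e` slowed to 206's `δ₁ ≤ δ_e`)
  have hδw : ∀ (c : ℝ), 0 ≤ c → ∀ y y' : Tor M, c * Real.exp (-(δe * (unitTorusGeo L kk M).dist y y')) ≤ c * Real.exp (-(δ₁ * (unitTorusGeo L kk M).dist y y')) :=
    fun c hc y y' => mul_le_mul_of_nonneg_left (Real.exp_le_exp.mpr (neg_le_neg (mul_le_mul_of_nonneg_right hδ₁e (hd y y')))) hc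
  obtain ⟨hRn, hRn', hRdn, hRf, hRf', hRdf⟩ := cv_landauRows_of_global e mv kk r hL a hρR hρR hoR (hG1.mono (hδw ρR hρR)) (hG2.mono (hδw ρR hρR)) (hG3.mono (hδw oR hoR))
  have hRle' : (14 * Real.exp 1 * (1 + Fintype.card (Fin (d + 1))) * basisConst e * ((1 + Fintype.card (Fin (d + 1))) * ((3 + 2 * ((d : ℝ) + 1)) * rA))) * (1 + Fintype.card (Fin (d + 1) ⊕ Fin (d + 1))) + (R₁ * (((1 + Fintype.card ι * (@basisConst ι _ (Matrix mm mm ℂ) Matrix.frobeniusNormedAddCommGroup Matrix.frobeniusNormedSpace e * (2 * Real.sqrt (Fintype.card mm)) * (Real.sqrt (Fintype.card mm) * (2 * (rA * ((((L ^ kk : ℕ) : ℝ))⁻¹)))))) ^ ((d + 2) * L ^ kk) - 1) + ((1 + Fintype.card ι * (@basisConst ι _ (Matrix mm mm ℂ) Matrix.frobeniusNormedAddCommGroup Matrix.frobeniusNormedSpace e * (2 * Real.sqrt (Fintype.card mm)) * (Real.sqrt (Fintype.card mm) * (2 * (rA * ((((L ^ r * L ^ kk : ℕ) : ℝ))⁻¹))))))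 ^ ((d + 2) * (L ^ r * L ^ kk)) - 1)) + ρR) ≤ R₀ :=
    (add_assoc _ _ _).symm.trans_le hRle
  have hX := H mv kk r hk hw₀ e he A' hA' rA hrA hrA1 h1 h2 h3 hr2 ρR ρR oR oR hρR hρR hoR hoR hRle' hθle hRn hRn' hRdn hRf hRf' hRdf hKc hKf
  have hX' := hX.mono (K' := fun y y' => |D| * ((((L ^ kk : ℕ) : ℝ)) ^ (-(1 / 16 : ℝ)) + ((14 * Real.exp 1 * (1 + Fintype.card (Fin (d + 1))) * basisConst e * ((1 + Fintype.card (Fin (d + 1))) * ((3 + 2 * ((d : ℝ) + 1)) * rA))) * (1 + Fintype.card (Fin (d + 1) ⊕ Fin (d + 1))) * ((((L ^ kk : ℕ) : ℝ))⁻¹) + 2 * (R₁ * (20 * ((((L ^ kk : ℕ) : ℝ))⁻¹) + 4 * Fintype.card ι * (@basisConst ι _ (Matrix mm mm ℂ) Matrix.frobeniusNormedAddCommGroup Matrix.frobeniusNormedSpace e * (2 * Real.sqrt (Fintype.card mm)) * (Real.sqrt (Fintype.card mm) * ((3 ^ (d + 1) * (72 * ((d : ℝ) + 1) ^ 2 +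 9 * ((d : ℝ) + 1)) + (2 + 2 * Real.exp 1 + 2 * Real.exp 1 ^ 2 * ((d : ℝ) + 1))) * (rA * ((((L ^ kk : ℕ) : ℝ))⁻¹))))))) + (oR + oR))) * Real.exp (-(δG * (unitTorusGeo L kk M).dist y y'))) fun y y' => by
    have hd0 := hd y y'
    calc D * ((((L ^ kk : ℕ) : ℝ)) ^ (-(1 / 16 : ℝ)) + ((14 * Real.exp 1 * (1 + Fintype.card (Fin (d + 1))) * basisConst e * ((1 + Fintype.card (Fin (d + 1))) * ((3 + 2 * ((d : ℝ) + 1)) * rA))) * (1 + Fintype.card (Fin (d + 1) ⊕ Fin (d + 1))) * ((((L ^ kk : ℕ) : ℝ))⁻¹) + 2 * (R₁ * (20 * ((((L ^ kk : ℕ) : ℝ))⁻¹) + 4 * Fintype.card ι * (@basisConst ι _ (Matrix mm mm ℂ) Matrix.frobeniusNormedAddCommGroup Matrix.frobeniusNormedSpace e * (2 * Real.sqrt (Fintype.card mm)) * (Real.sqrt (Fintype.card mm) * ((3 ^ (d + 1) * (72 * ((d : ℝ) + 1) ^ 2 + 9 * ((d : ℝ) + 1)) + (2 + 2 * Real.exp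 1 + 2 * Real.exp 1 ^ 2 * ((d : ℝ) + 1))) * (rA * ((((L ^ kk : ℕ) : ℝ))⁻¹))))))) + (oR + oR))) * Real.exp (-(δ₁ / 16 * (unitTorusGeo L kk M).dist y y'))
        ≤ |D| * ((((L ^ kk : ℕ) : ℝ)) ^ (-(1 / 16 : ℝ)) + ((14 * Real.exp 1 * (1 + Fintype.card (Fin (d + 1))) * basisConst e * ((1 + Fintype.card (Fin (d + 1))) * ((3 + 2 * ((d : ℝ) + 1)) * rA))) * (1 + Fintype.card (Fin (d + 1) ⊕ Fin (d + 1))) * ((((L ^ kk : ℕ) : ℝ))⁻¹) + 2 * (R₁ * (20 * ((((L ^ kk : ℕ) : ℝ))⁻¹) + 4 * Fintype.card ι * (@basisConst ι _ (Matrix mm mm ℂ) Matrix.frobeniusNormedAddCommGroup Matrix.frobeniusNormedSpace e * (2 * Real.sqrt (Fintype.card mm)) * (Real.sqrt (Fintype.card mm) * ((3 ^ (d + 1) * (72 * ((d : ℝ) + 1) ^ 2 + 9 * ((d : ℝ) + 1)) + (2 + 2 * Real.exp 1 + 2 * Real.exp 1 ^ 2 * ((d : ℝ) + 1))) * (rA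 * ((((L ^ kk : ℕ) : ℝ))⁻¹))))))) + (oR + oR))) * Real.exp (-(δ₁ / 16 * (unitTorusGeo L kk M).dist y y')) :=
          mul_le_mul_of_nonneg_right (mul_le_mul_of_nonneg_right (le_abs_self D) hbr0) (Real.exp_nonneg _)
      _ ≤ |D| * ((((L ^ kk : ℕ) : ℝ)) ^ (-(1 / 16 : ℝ)) + ((14 * Real.exp 1 * (1 + Fintype.card (Fin (d + 1))) * basisConst e * ((1 + Fintype.card (Fin (d + 1))) * ((3 + 2 * ((d : ℝ) + 1)) * rA))) * (1 + Fintype.card (Fin (d + 1) ⊕ Fin (d + 1))) * ((((L ^ kk : ℕ) : ℝ))⁻¹) + 2 * (R₁ * (20 * ((((L ^ kk : ℕ) : ℝ))⁻¹) + 4 * Fintype.card ι * (@basisConst ι _ (Matrix mm mm ℂ) Matrix.frobeniusNormedAddCommGroup Matrix.frobeniusNormedSpace e * (2 * Real.sqrt (Fintype.card mm)) * (Real.sqrt (Fintype.card mm) * ((3 ^ (d + 1) * (72 * ((d : ℝ) + 1) ^ 2 + 9 * ((d : ℝ) + 1)) + (2 + 2 * Real.exp 1 + 2 * Real.exp 1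 ^ 2 * ((d : ℝ) + 1))) * (rA * ((((L ^ kk : ℕ) : ℝ))⁻¹))))))) + (oR + oR))) * Real.exp (-(δG * (unitTorusGeo L kk M).dist y y')) :=
          mul_le_mul_of_nonneg_left (Real.exp_le_exp.mpr (by nlinarith)) (mul_nonneg (abs_nonneg D) hbr0)
  -- FILE 21 conjunct 6: the defect of `(G′, G) ⊗ 1_ι`
  obtain ⟨-, -, -, -, -, hDG0, -⟩ := HG (⟨mv + 1, kk, hk, r⟩, (0 : Fin (d + 1)))
  have hDG : HasMaj (CvNorm d L mv kk hL ι) (BlockNorm.ofBlocks (unitTorusGeo L kk M) (liftBlk (cvBlk d L mv kk hL ∘ kingPrV L kk r M) ι))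
      (idef (pull (liftMap (kingPrV L kk r M) ι)) (pull (liftMap (kingPrV L kk r M) ι)) (tensorId ι (gOp M (L ^ r * L ^ kk) a)) (tensorId ι (gOp M (L ^ kk) a)))
      (fun y y' => m₀ * ((L : ℝ) ^ kk) ^ (-(1 / 16 : ℝ)) * Real.exp (-(δG * (unitTorusGeo L kk M).dist y y'))) := hDG0
  have hcast : ((L : ℝ) ^ kk) = (((L ^ kk : ℕ) : ℝ)) := by push_cast; rfl
  rw [hcast] at hDG
  have hbk : cvBlk d L mv kk hL ∘ kingPrV L kk r M = fun i' : CvX' d L mv kk r hL => blockOf (L ^ r * L ^ kk) M i'.1 := blkFine_comp_kingPrV (M := M) L kk r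
  rw [hbk] at hX' hDG
  -- linearity of `𝔇` in the pair, and the constant
  rw [idef_sub]
  refine (hX'.sub hDG).mono fun y y' => ?_
  have hE := Real.exp_nonneg (-(δG * (unitTorusGeo L kk M).dist y y'))
  have p1 : m₀ * (((L ^ kk : ℕ) : ℝ)) ^ (-(1 / 16 : ℝ)) * Real.exp (-(δG * (unitTorusGeo L kk M).dist y y')) ≤
      m₀ * ((((L ^ kk : ℕ) : ℝ)) ^ (-(1 / 16 : ℝ)) + ((14 * Real.exp 1 * (1 + Fintype.card (Fin (d + 1))) * basisConst e * ((1 + Fintype.card (Fin (d + 1))) * ((3 + 2 * ((d : ℝ) + 1)) * rA))) * (1 + Fintype.card (Fin (d + 1) ⊕ Fin (d + 1))) * ((((L ^ kk : ℕ) : ℝ))⁻¹) + 2 * (R₁ * (20 * ((((L ^ kk : ℕ) : ℝ))⁻¹) + 4 * Fintype.card ι * (@basisConst ι _ (Matrix mm mm ℂ) Matrix.frobeniusNormedAddCommGroup Matrix.frobeniusNormedSpace e * (2 * Real.sqrt (Fintype.card mm)) * (Real.sqrt (Fintype.card mm) * ((3 ^ (d + 1) * (72 * ((d : ℝ) + 1)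 ^ 2 + 9 * ((d : ℝ) + 1)) + (2 + 2 * Real.exp 1 + 2 * Real.exp 1 ^ 2 * ((d : ℝ) + 1))) * (rA * ((((L ^ kk : ℕ) : ℝ))⁻¹))))))) + (oR + oR))) * Real.exp (-(δG * (unitTorusGeo L kk M).dist y y')) :=
    mul_le_mul_of_nonneg_right (mul_le_mul_of_nonneg_left hbrt hm₀.le) hE
  nlinarith [p1, mul_nonneg (mul_nonneg (abs_nonneg D) hbr0) hE, mul_nonneg (mul_nonneg hm₀.le hbr0) hE]

end Defect

end Summit.QuantumFields.YangMills.BalabanUVNodes.N15.GluedZeroField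

end
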